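import Summits.QuantumFields.BalabanUV.Beta.D1BFx.PackedColumnBlockIndexedMass
import Summits.QuantumFields.BalabanUV.Beta.BlockFaceCount

/-!
# `BalabanUV.Beta.D1BFx.PackedFaceSumMass` — road «BF-x» junction (J1), the face family's block table: **THE MASS OF A `gaugeWt`-WEIGHTED COMBINATION OF
# TABLES (leaf-03's `faceSum`) FROM A UNIFORM PER-SLOT LETTER ON ITS SLOTS — `≤ e^{2σR}·(d+1)·2N^d·ρ`, i.e. «FACE-PACK»'s `hFm ≤ n³·m̄F` AT `d = 3` WITH
# `m̄F := 8·e^{2σR}·ρ`** (UNCONDITIONAL; [folklore]: «FACE-PACK» §4 + «FACE-COUNT»)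

HONEST DEPENDENCY (cell records, verbatim): «continuum YM on T⁴ ⇐ BetaPertH ∧ nine spine estimates (0/9 proved); BetaPertH ⇐ (D1) ∧ (D4) ∧
CAP+tail; G-an2-4 gates asym, D1 and NE2/3/4.»  HONEST FRAMING (cell contract, verbatim): «discharging `BetaPertH` makes Bałaban's UV stability
UNCONDITIONAL — a real constructive-QFT result; it is NOT the continuum limit and NOT the Clay problem.»  THIS MODULE DISCHARGES NOTHING of the
wall: [folklore] bookkeeping BY NAME over this lineage's `PackedColumnBlockIndexedMass.mass_blk_finset_sum_smul_recentre_le` (any index type) and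
`BlockFaceCount.sum_univ_sum_abs_gaugeWt_le`.  The per-slot letter `ρ` is a DISPLAYED hypothesis on an ARBITRARY family; nothing of Bałaban's (or an1's ∕
an3's) tables asserted.  No definition, no `def … : Prop`, nothing cited, 0 sorry.  NO (1.22) row; 0 root-level binders of row D1 discharged; (J1) = ONE OPEN
ROW; [W] OPEN; (K) NOT closed; NOT D1, NOT `BetaPertH`, NOT continuum, NOT Clay.

ABSOLUTE RULE (cell charter, verbatim): «No internally-minted statement may enter as a cited fact. Every hypothesis is either kernel-proved in
this package or a verbatim quotation of a PUBLISHED theorem with page reference. The manuscript(s) under audit are NOT citable for their own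
disputed steps — they are the thing under adjudication; programme-internal (2001/route/tribunal) claims are never citable.»

WHY: the third input of the face family's (R-c2) [M] row (my R-1, journal) is the face-sum block table's mass `hFm ≤ n³·m̄F`; leaf-03's
`SymCorrectorFace.faceSum n T y′ = Σ_{κ′} Σ_{u ∈ bondNbhd n y′ κ′} gaugeWt n y′ κ′ u • T κ′ u` (`faceSum_apply`, `rfl`) is a `gaugeWt`-weighted combination, so
with a UNIFORM per-slot `u`-centred letter `ρ j k` on its slots and all slots within `R` of the centre (`l1_le_of_mem_bondNbhd`: `R = (d+1)·n` from a block
site) its `c`-centred block mass is `≤ e^{2σR}·Σ |gaugeWt|·ρ ≤ e^{2σR}·(d+1)·2N^d·ρ` — ONE POWER OF `N` BELOW the slot count of the neighbourhood; at `d = 3`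
this is `N³·(8·e^{2σR}·ρ j k)`, the `hFm` binder of `mass_blk_vertexOfK_G₀_le_of_blockIndexed_split`.  What remains displayed after this file: the per-slot
letter `ρ` of the raw tables ON THE FACE-CROSSING SLOTS (the table author's ∕ Engine C's number) — not the interior per-slot sup that (M-b) retired.

CONTENT ([folklore], `d = 3`): **`mass_blk_gaugeWt_combination_le`** (any finsets `Φ κ′` of slots, any family `T`, generic `σ, R, ρ`);
**`hFm_of_faceSlotLetter`** (the `≤ N³·(8·e^{2σR}·ρ j k)` form).
Unit `b2b-balaban-gan24-formalise-leaf-05` (gen 58), G-an2-4 swarm leaf prover 05, road «BF-x» supplier; INTENT-3 (journal).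
-/

noncomputable section

open Finset
open scoped BigOperators
open Literature.MathematicalPhysics.QuantumFieldTheory
open Literature.MathematicalPhysics.QuantumFieldTheory.Balaban1983to89
open Literature.MathematicalPhysics.QuantumFieldTheory.Balaban1983to89.Beta
open B12Sec2to5 (l1 l1_nonneg)
open ExpKernelCalculus (Site MKer)
open OneStepResolventKernel (Fib)
open Summit.QuantumFields.BalabanUV.Beta.D1BFx.PackedKernelSplit (blk)
open Summit.QuantumFields.BalabanUV.Beta.KernelWardRelative (gaugeWt)
open Summit.QuantumFields.BalabanUV.Beta.BlockFaceCount (sum_univ_sum_abs_gaugeWt_le)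
open Summit.QuantumFields.BalabanUV.Beta.D1BFx.PackedColumnBlockIndexedMass (mass_blk_finset_sum_smul_recentre_le)

namespace Summit.QuantumFields.BalabanUV.Beta.D1BFx.PackedFaceSumMass

/-- [folklore] **THE BLOCK MASSES OF A `gaugeWt`-WEIGHTED COMBINATION OF TABLES FROM A UNIFORM PER-SLOT LETTER** (`d = 3`): for `N ≥ 1`, a coarse block `y`, finsets of slots
`Φ κ′` all within `|u − c|₁ ≤ R` of one centre `c`, `0 ≤ σ`, and a family `T` whose blocks have summable `u`-centred `σ`-masses `≤ ρ j k` on those slots (`0 ≤ ρ j k`):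
every block of `Σ_{κ′} Σ_{u ∈ Φ κ′} gaugeWt N y κ′ u • T κ′ u` has summable `c`-centred `σ`-mass `≤ e^{2σR}·((3+1)·(2·N³))·ρ j k` («FACE-PACK» §4 on the sigma-indexed
combination + «FACE-COUNT»). -/
theorem mass_blk_gaugeWt_combination_le {N : ℕ} (hN : 1 ≤ N) (y c : Fin (3 + 1) → ℤ) (Φ : Fin (3 + 1) → Finset (Fin (3 + 1) → ℤ))
    {T : Fin (3 + 1) → (Fin (3 + 1) → ℤ) → MKer 4 (Fib 3)} {σ R : ℝ} (hσ : 0 ≤ σ) {ρ : Bool → Bool → ℝ}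
    (hTs : ∀ κ', ∀ u ∈ Φ κ', ∀ j k, Summable fun p : Site 4 × Site 4 =>
      ∑ g, ∑ f, |blk (T κ' u) j k p.1 p.2 g f| * Real.exp (σ * (l1 (p.1 - u) + l1 (p.2 - u))))
    (hTm : ∀ κ', ∀ u ∈ Φ κ', ∀ j k, ∑' p : Site 4 × Site 4,
      ∑ g, ∑ f, |blk (T κ' u) j k p.1 p.2 g f| * Real.exp (σ * (l1 (p.1 - u) + l1 (p.2 - u))) ≤ ρ j k)
    (hR : ∀ κ', ∀ u ∈ Φ κ', l1 (u - c) ≤ R) (j k : Bool) (hρ : 0 ≤ ρ j k) :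
    (Summable fun p : Site 4 × Site 4 => ∑ g, ∑ f,
        |blk (∑ κ' : Fin (3 + 1), ∑ u ∈ Φ κ', gaugeWt N y κ' u • T κ' u) j k p.1 p.2 g f| * Real.exp (σ * (l1 (p.1 - c) + l1 (p.2 - c)))) ∧
      ∑' p : Site 4 × Site 4, ∑ g, ∑ f,
          |blk (∑ κ' : Fin (3 + 1), ∑ u ∈ Φ κ', gaugeWt N y κ' u • T κ' u) j k p.1 p.2 g f| * Real.exp (σ * (l1 (p.1 - c) + l1 (p.2 - c)))
        ≤ Real.exp (2 * σ * R) * ((((3 : ℝ) + 1) * (2 * (N : ℝ) ^ 3)) * ρ j k) := by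
  -- one sigma-indexed finset
  have e : (∑ κ' : Fin (3 + 1), ∑ u ∈ Φ κ', gaugeWt N y κ' u • T κ' u)
      = ∑ s ∈ (Finset.univ : Finset (Fin (3 + 1))).sigma Φ, gaugeWt N y s.1 s.2 • T s.1 s.2 := by
    rw [Finset.sum_sigma]
  rw [e]
  obtain ⟨hs, hb⟩ := mass_blk_finset_sum_smul_recentre_le ((Finset.univ : Finset (Fin (3 + 1))).sigma Φ)
    (a := fun s => gaugeWt N y s.1 s.2) (T := fun s => T s.1 s.2) (q := fun s => s.2) (ρ := fun _ j k => ρ j k) hσ c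
    (fun s hs' => hTs s.1 s.2 (Finset.mem_sigma.1 hs').2) (fun s hs' => hTm s.1 s.2 (Finset.mem_sigma.1 hs').2)
    (fun s hs' => hR s.1 s.2 (Finset.mem_sigma.1 hs').2) j k
  refine ⟨hs, hb.trans ?_⟩
  -- the count: `Σ_s |gaugeWt| ≤ (d+1)·2N^d`
  have hcount : ∑ s ∈ (Finset.univ : Finset (Fin (3 + 1))).sigma Φ, |gaugeWt N y s.1 s.2| * ρ j k ≤ (((3 : ℝ) + 1) * (2 * (N : ℝ) ^ 3)) * ρ j k := by
    rw [← Finset.sum_mul]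
    refine mul_le_mul_of_nonneg_right ?_ hρ
    rw [Finset.sum_sigma]
    have h := sum_univ_sum_abs_gaugeWt_le (d := 3) hN y Φ
    push_cast at h ⊢
    linarith
  exact mul_le_mul_of_nonneg_left hcount (Real.exp_pos _).le

/-- [folklore] **«FACE-PACK»'s `hFm` FROM A UNIFORM FACE-SLOT LETTER**: in the binder shape `≤ N³·m̄F j k` of `PackedColumnBlockIndexedMass.mass_blk_vertexOfK_G₀_le_of_blockIndexed_split`,
with `m̄F j k := 8·e^{2σR}·ρ j k`. -/
theorem hFm_of_faceSlotLetter {N : ℕ} (hN : 1 ≤ N) (y c : Fin (3 + 1) → ℤ) (Φ : Fin (3 + 1) → Finset (Fin (3 + 1) → ℤ))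
    {T : Fin (3 + 1) → (Fin (3 + 1) → ℤ) → MKer 4 (Fib 3)} {σ R : ℝ} (hσ : 0 ≤ σ) {ρ : Bool → Bool → ℝ}
    (hTs : ∀ κ', ∀ u ∈ Φ κ', ∀ j k, Summable fun p : Site 4 × Site 4 =>
      ∑ g, ∑ f, |blk (T κ' u) j k p.1 p.2 g f| * Real.exp (σ * (l1 (p.1 - u) + l1 (p.2 - u))))
    (hTm : ∀ κ', ∀ u ∈ Φ κ', ∀ j k, ∑' p : Site 4 × Site 4,
      ∑ g, ∑ f, |blk (T κ' u) j k p.1 p.2 g f| * Real.exp (σ * (l1 (p.1 - u) + l1 (p.2 - u))) ≤ ρ j k)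
    (hR : ∀ κ', ∀ u ∈ Φ κ', l1 (u - c) ≤ R) (j k : Bool) (hρ : 0 ≤ ρ j k) :
    (Summable fun p : Site 4 × Site 4 => ∑ g, ∑ f,
        |blk (∑ κ' : Fin (3 + 1), ∑ u ∈ Φ κ', gaugeWt N y κ' u • T κ' u) j k p.1 p.2 g f| * Real.exp (σ * (l1 (p.1 - c) + l1 (p.2 - c)))) ∧
      ∑' p : Site 4 × Site 4, ∑ g, ∑ f,
          |blk (∑ κ' : Fin (3 + 1), ∑ u ∈ Φ κ', gaugeWt N y κ' u • T κ' u) j k p.1 p.2 g f| * Real.exp (σ * (l1 (p.1 - c) + l1 (p.2 - c)))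
        ≤ (N : ℝ) ^ 3 * (8 * Real.exp (2 * σ * R) * ρ j k) := by
  obtain ⟨hs, hb⟩ := mass_blk_gaugeWt_combination_le hN y c Φ (T := T) hσ hTs hTm hR j k hρ
  exact ⟨hs, hb.trans (le_of_eq (by ring))⟩

end Summit.QuantumFields.BalabanUV.Beta.D1BFx.PackedFaceSumMass

end
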